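import Literature.Computability.Complexity.ParallelRepetitionExpanding
import HarnessLib
/-!
# Parallel repetition, III: expanderisation and the gap amplification theorem for projection games

Topic `Computability/Complexity`, namespace `Literature.Computability.Complexity.ProjGame`.
Dinur–Steurer, *Analytical approach to parallel repetition* (STOC 2014; arXiv:1305.1979),
Claim 8.1 and §3.3, PROVED:

* `expand G n α₀` — **Claim 8.1** ("reduction to expanding games"), in its regular form: next to
  `n` parallel copies of every edge of `G`, add `n` new vertices `u₀` of Alice, each joined to the
  Bob endpoint of every edge of `G` (with that edge's weight) by the trivial constraint `π₀`
  "accept iff Alice answers `α₀`"; then `val(G') = ½ + ½ val(G)` (`valLe_expand`, `sat_expand`)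
  and the symmetrized walk of `G'` is `½ A_G + ½ J` (`symForm_expand`), so `G'` is
  `½`-expanding (`spectral_expand`: "the symmetrized game corresponding to `{u₀} × μ_V × {π₀}` is
  the complete graph, with eigenvalue gap `1`").
* **Gap amplification for projection games** (`valLe_pow_expand`, `sat_pow_expand`; §3.3 "short
  proof for the hardness of label cover"): if `val(G) ≤ 1 - ε₀` (`0 < ε₀ ≤ 1`) then
  `val((G')^{⊗k}) ≤ (1 - ε₀/180)^k`, while `val(G) = 1 ⇒ val((G')^{⊗k}) = 1` — by Thm. 3.4
  (`lamLe_of_spectral`, with `γ = ½`, `η = ε₀/2`, `dsEps ½ (ε₀/2) = ε₀/90`), Thm. 3.2 iterated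
  (`valLe_pow`) and `√(1 - ε₀/90) ≤ 1 - ε₀/180`.

This is the combinatorial core of "`labelcover(1, δ)` is NP-hard for all `δ > 0`" from the basic
PCP theorem (§3.3); the list-encoded label cover instances and the polynomial-time computability of
`G ↦ (G')^{⊗k}` are treated separately (`LabelCover.lean` and its sequels).

## References

* I. Dinur, D. Steurer, *Analytical approach to parallel repetition*, Proc. 46th STOC (2014)
  624–633; arXiv:1305.1979: Claim 8.1 (§8), §3.3, Thm. 3.2, Thm. 3.4.
-/

namespace Literature.Computability.Complexity

open Finset

namespace ProjGame

variable {E V U β α : Type} [Fintype E] [Fintype V] [Fintype U] [Fintype β] [Fintype α]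
  [DecidableEq V] [DecidableEq U] [DecidableEq β] [DecidableEq α]
  (G : ProjGame E V U β α)

/-! ### Expanderisation (Claim 8.1, regular form) -/

section Expand

variable [Nonempty E] (n : ℕ) [NeZero n] (a₀ : α)

/-- **Dinur–Steurer's reduction to expanding games** (Claim 8.1, regular form): the game `G'` with
Alice's vertices `U ⊕ Fin n`; edges: `n` parallel copies `(e, i)` of every edge `e` of `G`, and for
every new vertex `u₀ = i` and every edge `e` of `G` a trivial edge `(i, e)` from `src e` to `u₀`
with the weight of `e`, accepted iff Alice answers `α₀` ("`π₀` is a 'trivial' constraint that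
accepts when Alice answers `1` regardless of Bob's answer"). The trivial part has the same total
weight as the `G`-part, and from every `u₀` Bob's vertex is distributed as `μ_V`.
[cite: DinurSteurer2014, Claim 8.1] -/
def expand : ProjGame ((E × Fin n) ⊕ (Fin n × E)) V (U ⊕ Fin n) β α where
  src := Sum.elim (fun p => G.src p.1) (fun p => G.src p.2)
  dst := Sum.elim (fun p => Sum.inl (G.dst p.1)) (fun p => Sum.inr p.1)
  proj := Sum.elim (fun p => G.proj p.1) (fun _ _ => some a₀)
  wt := Sum.elim (fun p => G.wt p.1) (fun p => G.wt p.2)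
  wt_pos := by
    rintro (p | p)
    · exact G.wt_pos p.1
    · exact G.wt_pos p.2
  src_surj v := by
    obtain ⟨e, he⟩ := G.src_surj v
    exact ⟨Sum.inl (e, 0), he⟩
  dst_surj := by
    rintro (u | i)
    · obtain ⟨e, he⟩ := G.dst_surj u
      exact ⟨Sum.inl (e, 0), by simp [he]⟩
    · obtain ⟨e⟩ := ‹Nonempty E›
      exact ⟨Sum.inr (i, e), rfl⟩

omit [Fintype V] [Fintype U] [Fintype β] [Fintype α] [DecidableEq V] [DecidableEq U] [DecidableEq β] [DecidableEq α] in
/-- Total weight of `G'`: `2n · total`. [cite: DinurSteurer2014, Claim 8.1] -/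
theorem total_expand : (G.expand n a₀).total = 2 * n * G.total := by
  unfold total
  rw [Fintype.sum_sum_type, Fintype.sum_prod_type, Fintype.sum_prod_type]
  simp only [expand, Sum.elim_inl, Sum.elim_inr, sum_const, card_univ, Fintype.card_fin, nsmul_eq_mul]
  rw [← mul_sum]
  ring

omit [Fintype V] [Fintype U] [Fintype β] [Fintype α] [DecidableEq V] [DecidableEq β] [DecidableEq α] in
/-- `wU` of an old vertex of Alice: `n · wU u`. [cite: DinurSteurer2014, Claim 8.1] -/
theorem wU_expand_inl (u : U) : (G.expand n a₀).wU (Sum.inl u) = n * G.wU u := by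
  unfold wU
  rw [Fintype.sum_sum_type, Fintype.sum_prod_type, Fintype.sum_prod_type]
  simp only [expand, Sum.elim_inl, Sum.elim_inr, Sum.inl.injEq, reduceCtorEq, if_false, sum_const_zero, add_zero]
  simp only [sum_const, card_univ, Fintype.card_fin, nsmul_eq_mul, mul_sum]

omit [Fintype V] [Fintype U] [Fintype β] [Fintype α] [DecidableEq V] [DecidableEq β] [DecidableEq α] in
/-- `wU` of a new vertex of Alice: `total`. [cite: DinurSteurer2014, Claim 8.1] -/
theorem wU_expand_inr (i : Fin n) : (G.expand n a₀).wU (Sum.inr i) = G.total := by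
  unfold wU total
  rw [Fintype.sum_sum_type, Fintype.sum_prod_type, Fintype.sum_prod_type]
  simp only [expand, Sum.elim_inl, Sum.elim_inr, Sum.inr.injEq, reduceCtorEq, if_false, sum_const_zero, zero_add]
  rw [show (∑ x : Fin n, ∑ y, if x = i then G.wt y else 0) = ∑ x : Fin n, if x = i then ∑ y, G.wt y else 0 from
    sum_congr rfl fun x _ => by rw [Finset.sum_ite_irrel, Finset.sum_const_zero]]
  rw [sum_ite_eq' univ i, if_pos (mem_univ _)]

omit [Fintype V] [Fintype U] [Fintype β] [Fintype α] [DecidableEq V] [DecidableEq U] [DecidableEq β] [DecidableEq α] in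
/-- A weighted sum over the edges of `G'` of a function of (source vertex, weight-carrying edge):
`∑_{e'} w'_{e'} F(src' e') = 2n ∑_e w_e F(src e)`. [folklore] -/
theorem sum_wt_expand (F : V → ℝ) :
    ∑ e', (G.expand n a₀).wt e' * F ((G.expand n a₀).src e') = 2 * n * ∑ e, G.wt e * F (G.src e) := by
  rw [Fintype.sum_sum_type, Fintype.sum_prod_type, Fintype.sum_prod_type]
  simp only [expand, Sum.elim_inl, Sum.elim_inr, sum_const, card_univ, Fintype.card_fin, nsmul_eq_mul]
  rw [← mul_sum]
  ring

omit [Fintype V] [Fintype U] [Fintype β] [Fintype α] [DecidableEq V] [DecidableEq U] [DecidableEq β] [DecidableEq α] in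
/-- `‖g‖²` is unchanged by expanderisation (same marginal on Bob's side). [cite: DinurSteurer2014, Claim 8.1] -/
theorem normVE_expand (g : V → ℝ) : (G.expand n a₀).normVE g = G.normVE g := by
  unfold normVE
  rw [G.sum_wt_expand n a₀ (fun v => g v ^ 2), total_expand]
  have hn : (n : ℝ) ≠ 0 := Nat.cast_ne_zero.2 (NeZero.ne n)
  have hW := G.total_pos.ne'
  field_simp

omit [Fintype V] [Fintype U] [Fintype β] [Fintype α] [DecidableEq V] [DecidableEq U] [DecidableEq β] [DecidableEq α] in
/-- `ḡ` is unchanged by expanderisation. [cite: DinurSteurer2014, Claim 8.1] -/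
theorem meanE_expand (g : V → ℝ) : (G.expand n a₀).meanE g = G.meanE g := by
  unfold meanE
  rw [sum_wt_expand, total_expand]
  have hn : (n : ℝ) ≠ 0 := Nat.cast_ne_zero.2 (NeZero.ne n)
  have hW := G.total_pos.ne'
  field_simp

omit [Fintype V] [Fintype β] [Fintype α] [DecidableEq V] [DecidableEq β] [DecidableEq α] in
/-- **The symmetrized walk of `G'` is `½ A_G + ½ J`**: `⟨g, A' g⟩ = ½ ⟨g, A g⟩ + ½ ḡ²` (from an old
vertex of Alice one sees `G`'s walk, from a new one Bob's vertex is redistributed as `μ_V`).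
[cite: DinurSteurer2014, Claim 8.1 (proof)] -/
theorem symForm_expand (g : V → ℝ) :
    (G.expand n a₀).symForm g = G.symForm g / 2 + G.meanE g ^ 2 / 2 := by
  have hn : (n : ℝ) ≠ 0 := Nat.cast_ne_zero.2 (NeZero.ne n)
  have hn0 : (0 : ℝ) < n := Nat.cast_pos.2 (Nat.pos_of_ne_zero (NeZero.ne n))
  have hW := G.total_pos.ne'
  unfold symForm
  rw [Fintype.sum_sum_type, total_expand]
  congr 1
  · -- old vertices of Alice
    rw [sum_div]
    refine sum_congr rfl fun u _ => ?_
    rw [wU_expand_inl]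
    have hin : (∑ e', if (G.expand n a₀).dst e' = Sum.inl u then (G.expand n a₀).wt e' * g ((G.expand n a₀).src e') else 0) =
        n * ∑ e, if G.dst e = u then G.wt e * g (G.src e) else 0 := by
      rw [Fintype.sum_sum_type, Fintype.sum_prod_type, Fintype.sum_prod_type]
      simp only [expand, Sum.elim_inl, Sum.elim_inr, Sum.inl.injEq, reduceCtorEq, if_false, sum_const_zero, add_zero]
      simp only [sum_const, card_univ, Fintype.card_fin, nsmul_eq_mul, mul_sum]
    rw [hin]
    have hwU := (G.wU_pos u).ne'
    field_simp
  · -- new vertices of Alice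
    have hin : ∀ i : Fin n, (∑ e', if (G.expand n a₀).dst e' = Sum.inr i then
        (G.expand n a₀).wt e' * g ((G.expand n a₀).src e') else 0) = ∑ e, G.wt e * g (G.src e) := fun i => by
      rw [Fintype.sum_sum_type, Fintype.sum_prod_type, Fintype.sum_prod_type]
      simp only [expand, Sum.elim_inl, Sum.elim_inr, Sum.inr.injEq, reduceCtorEq, if_false, sum_const_zero, zero_add]
      rw [show (∑ x : Fin n, ∑ y, if x = i then G.wt y * g (G.src y) else 0) =
          ∑ x : Fin n, if x = i then ∑ y, G.wt y * g (G.src y) else 0 from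
        sum_congr rfl fun x _ => by rw [Finset.sum_ite_irrel, Finset.sum_const_zero]]
      rw [sum_ite_eq' univ i, if_pos (mem_univ _)]
    simp_rw [hin, wU_expand_inr]
    rw [sum_const, card_univ, Fintype.card_fin, nsmul_eq_mul]
    unfold meanE
    field_simp

omit [Fintype V] [Fintype β] [Fintype α] [DecidableEq V] [DecidableEq β] [DecidableEq α] in
/-- **Expanderised games are `½`-expanding** (Claim 8.1: eigenvalue gap `≥ γ` with `γ = ½`).
[cite: DinurSteurer2014, Claim 8.1] -/
theorem spectral_expand : (G.expand n a₀).Spectral (1 / 2) := fun g => by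
  rw [symForm_expand, normVE_expand, meanE_expand]
  have := G.symForm_le_normVE g
  linarith

omit [Fintype V] [Fintype U] [Fintype β] [Fintype α] [DecidableEq V] [DecidableEq U] [DecidableEq β] in
/-- **`val(G') ≤ ½ + ½ val(G)`**: if `val(G) ≤ 1 - ε₀` then `val(G') ≤ 1 - ε₀/2` (the trivial half
is always satisfiable). [cite: DinurSteurer2014, Claim 8.1 ("`val(G') = ½ + ½ val(G)`")] -/
theorem valLe_expand {ε₀ : ℝ} (hval : G.ValLe (1 - ε₀)) : (G.expand n a₀).ValLe (1 - ε₀ / 2) := by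
  intro b a
  have hn0 : (0 : ℝ) ≤ n := Nat.cast_nonneg n
  have hG := hval b (fun u => a (Sum.inl u))
  have hle : ∀ e, (if G.proj e (b (G.src e)) = some (a (Sum.inl (G.dst e))) then G.wt e else 0) ≤ G.wt e :=
    fun e => by split_ifs; exacts [le_rfl, G.wt_nonneg e]
  unfold satW
  rw [total_expand, Fintype.sum_sum_type, Fintype.sum_prod_type, Fintype.sum_prod_type]
  simp only [expand, Sum.elim_inl, Sum.elim_inr, sum_const, card_univ, Fintype.card_fin, nsmul_eq_mul]
  -- the `G`-part
  have h1 : ∑ e, (n : ℝ) * (if G.proj e (b (G.src e)) = some (a (Sum.inl (G.dst e))) then G.wt e else 0) ≤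
      n * ((1 - ε₀) * G.total) := by
    rw [← mul_sum]; exact mul_le_mul_of_nonneg_left hG hn0
  -- the trivial part
  have h2 : ∑ i : Fin n, ∑ e, (if some a₀ = some (a (Sum.inr i)) then G.wt e else 0) ≤ n * G.total := by
    calc ∑ i : Fin n, ∑ e, (if some a₀ = some (a (Sum.inr i)) then G.wt e else 0) ≤ ∑ _i : Fin n, G.total :=
          sum_le_sum fun i _ => sum_le_sum fun e _ => by split_ifs; exacts [le_rfl, G.wt_nonneg e]
      _ = n * G.total := by rw [sum_const, card_univ, Fintype.card_fin, nsmul_eq_mul]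
  have : (1 - ε₀ / 2) * (2 * n * G.total) = n * ((1 - ε₀) * G.total) + n * G.total := by ring
  rw [this]
  exact add_le_add h1 h2

omit [Fintype E] [Fintype V] [Fintype U] [Fintype β] [Fintype α] [DecidableEq V] [DecidableEq U] [DecidableEq β] [DecidableEq α] in
/-- Strategies satisfying every edge of `G` extend (Alice answers `α₀` at the new vertices) to
strategies satisfying every edge of `G'`. [cite: DinurSteurer2014, Claim 8.1] -/
theorem sat_expand {b : V → β} {a : U → α} (h : ∀ e, G.proj e (b (G.src e)) = some (a (G.dst e))) :
    ∀ e', (G.expand n a₀).proj e' (b ((G.expand n a₀).src e')) = some (Sum.elim a (fun _ => a₀) ((G.expand n a₀).dst e')) := by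
  rintro (p | p)
  · exact h p.1
  · rfl

end Expand

/-! ### The amplification theorem -/

section Amplify

variable [Nonempty E] (n : ℕ) [NeZero n] (a₀ : α)

/-- `dsEps ½ (ε₀/2) = ε₀/90` for `ε₀ ≤ 1`. [folklore] -/
theorem dsEps_half {ε₀ : ℝ} (hε₀1 : ε₀ ≤ 1) : dsEps (1 / 2) (ε₀ / 2) = ε₀ / 90 := by
  unfold dsEps
  rw [min_eq_right]
  · ring
  · rw [div_le_div_iff₀ (by norm_num) (by norm_num)]
    linarith

/-- `√(1 - ε₀/90) ≤ 1 - ε₀/180` for `ε₀ ≤ 1`. [folklore] -/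
theorem sqrt_one_sub_le {ε₀ : ℝ} (hε₀1 : ε₀ ≤ 1) : Real.sqrt (1 - ε₀ / 90) ≤ 1 - ε₀ / 180 := by
  have h0 : 0 ≤ 1 - ε₀ / 180 := by linarith
  calc Real.sqrt (1 - ε₀ / 90) ≤ Real.sqrt ((1 - ε₀ / 180) ^ 2) :=
        Real.sqrt_le_sqrt (by nlinarith [sq_nonneg ε₀])
    _ = 1 - ε₀ / 180 := Real.sqrt_sq h0

/-- **Gap amplification for projection games (Dinur–Steurer §3.3), NO side.** If `val(G) ≤ 1 - ε₀`
with `ε₀ ≤ 1`, then the `k`-fold parallel repetition of the expanderised game has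
`val((G')^{⊗k}) ≤ (1 - ε₀/180)^k`: `G'` is `½`-expanding with `val(G') ≤ 1 - ε₀/2`, so
`λ₊(G')² ≤ 1 - ε₀/90` (Thm. 3.4) and `val((G')^{⊗k}) ≤ ‖(G')^{⊗k}‖ ≤ λ₊(G')^k` (Claim 2.3, Thm. 3.2).
[cite: DinurSteurer2014, §3.3] -/
theorem valLe_pow_expand {ε₀ : ℝ} (hε₀1 : ε₀ ≤ 1) (hval : G.ValLe (1 - ε₀)) (k : ℕ) :
    ((G.expand n a₀).pow k).ValLe ((1 - ε₀ / 180) ^ k) := by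
  have hsp := G.spectral_expand n a₀
  have hval' := G.valLe_expand n a₀ hval
  have hlam := (G.expand n a₀).lamLe_of_spectral (γ := 1 / 2) (η := ε₀ / 2) (by norm_num) (by linarith) hsp hval'
  rw [dsEps_half hε₀1] at hlam
  have hc0 : (0 : ℝ) ≤ 1 - ε₀ / 90 := by linarith
  have h := (G.expand n a₀).valLe_pow hc0 hlam k
  refine h.mono (pow_le_pow_left₀ (Real.sqrt_nonneg _) (sqrt_one_sub_le hε₀1) k)

omit [Fintype V] [Fintype U] [Fintype β] [Fintype α] [DecidableEq V] [DecidableEq U] [DecidableEq β] in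
/-- **Gap amplification, YES side**: if `G` is satisfiable then so is `(G')^{⊗k}` — some strategies
satisfy constraints of full weight. [cite: DinurSteurer2014, §3.3 ("if `val(G) = 1` clearly `val(G^{⊗k}) = 1`")] -/
theorem sat_pow_expand {b : V → β} {a : U → α} (h : ∀ e, G.proj e (b (G.src e)) = some (a (G.dst e))) (k : ℕ) :
    ∃ bk ak, ((G.expand n a₀).pow k).satW bk ak = ((G.expand n a₀).pow k).total := by
  obtain ⟨bk, ak, hk⟩ := (G.expand n a₀).sat_pow (G.sat_expand n a₀ h) k
  exact ⟨bk, ak, ((G.expand n a₀).pow k).satW_eq_total_of_sat hk⟩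

end Amplify

end ProjGame

end Literature.Computability.Complexity
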